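import Summits.ResolutionOfSingularities.ResolutionOfSingularities.Theorems.RadicialJungCleanModelsLogContentIdealValued
import Summits.ResolutionOfSingularities.ResolutionOfSingularities.Theorems.RadicialJungCleanModelsLogContentIdealChart
import Literature.AlgebraicGeometry.Resolution.DerivationCompletion
import Mathlib.RingTheory.Localization.FractionRing
import HarnessLib

/-!
# Route `RadicialJung`, crux `CleanModels` (stmt-15917): the log-Jacobian content ideal at the
# points of the blow-up of a closed point (Giraud 1983, 2.5 — over an arbitrary ground field)

Support file (OURS) for PROGRAMME-clean-dim2 (brick K3c-iv, W8.1), line `via-clean-models` of the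
crux `DescentPerfectToAll` (stmt-0549). Nothing here is a statement of Hironaka's manuscript.

Setting (the chart algebra of the tree's quadratic-transform files, everything inside a field `K`):
`R ≤ T` subrings of `K` with `Frac R = K`, `x, y ∈ R`, `x ≠ 0`, `y/x ∈ T`, and `T` stable under
every derivation of `K` which preserves `R` and maps `y/x` into `T` — e.g. `T = R[y/x]`
(`derivation_mapsTo_adjoin`) or any of its localisations inside `K`
(`derivation_mapsTo_ofField`): the affine chart of the blowing up of `𝔪 = (x, y)` and its local
rings. `R` is assumed to have `Ω[R⁄ℤ]` projective and dual derivations `∂_x, ∂_y` of `(x, y)` —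
every regular local ring essentially of finite type over ANY field of characteristic `p`
(`projective_kaehler_int_of_zmod`, `exists_dual_derivations_int`). Content ideals are the
INTRINSIC ones, `J(T, f; log S) = ⟨D f : D ∈ Der(T), s ∣ D s (s ∈ S)⟩`, and
`N(R, f; x, y) = ⟨D f : D ∈ Der(R), D x = D y = 0⟩`. PROVED (Giraud's 2.5, both inclusions, no
`F`-finiteness):

* `map_span_logDerivation_eq_span_logDerivation_chart` — **`J(T, f; log x, log y/x) =
  J(R, f; log x, log y)·T`**: Giraud's "`J(X′, ω′, E(ω′)) = J(X, ω, E(ω))𝒪_{X′}`" (2.5, first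
  sentence) on the WHOLE chart — at a crossing point `ξ` of `E(f) = div(xy)` the total transform is
  `div(x · (y/x))`, and where `y/x` is a unit the condition `y/x ∣ D(y/x)` is vacuous;
* `span_logDerivation_chart_eq_map` — **`J(T, f; log x) = (x ∂_x f, x ∂_y f)T + N(R, f; x, y)T`**:
  the NON-crossing case (`E(f) = div(x)`, chart of `x`, where the total transform of `E(f)` is the
  exceptional curve `div(x)` alone) — Giraud's `J′ = y^a z^{a-1}(A, yzB, zC_ν)R′` of 2.5 read
  through `x ∂_x f = x^a A`, `∂_y f = x^a B`, `N = x^a (C_ν)`;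
* `exists_derivation_extend_of_isFractionRing` — derivations of `R` extend to `K = Frac R`.

With `span_logDerivation_apply_eq` (the generators `J(R, f; log x, y) = (x∂_x f, y∂_y f) + N`,
`J(R, f; log x) = (x∂_x f, ∂_y f) + N`) this is the complete dictionary between Giraud's ideals
before and after a point blow-up, chart by chart; the length side (his 2.1.1, 2.5 (A)/(B)) is in
`RadicialJungCleanModelsGiraudTotalColength*.lean` / `…GiraudInitialFormLength.lean`.

## References
* J. Giraud, Forme normale d'une fonction sur une surface de caractéristique positive, Bull. Soc.
  Math. France 111 (1983) 109–124: 1.1 (2), Rem. 1.6 (2)–(4), 2.5. [Giraud1983]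
* The Stacks Project, Tag 07PE (derivations extend to localisations). [StacksProject]
-/

noncomputable section

set_option linter.dupNamespace false -- mandated namespace of this single-conjunct summit

open KaehlerDifferential Module
open Literature.AlgebraicGeometry.Resolution

namespace Summit.ResolutionOfSingularities.ResolutionOfSingularities.Theorems.RadicialJung.CleanModels

universe u

variable {K : Type u} [Field K]

/-- **Derivations of `R` extend to `K = Frac R`** (`D(a/b) = (b Da − a Db)/b²`).
[cite: StacksProject, Tag 07PE (2)] -/
theorem exists_derivation_extend_of_isFractionRing (R : Subring K) [IsFractionRing R K]
    (D : Derivation ℤ R R) : ∃ D' : Derivation ℤ K K, ∀ r : R, D' r = D r := by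
  obtain ⟨D', hD'⟩ := exists_derivation_extend_of_isLocalizedModule (nonZeroDivisors R) K
    (Algebra.linearMap R K) D
  exact ⟨D', fun r => hD' r⟩

section Chart

variable {R T : Subring K} (hRT : R ≤ T) {x y : R} (f : R)
  {δ : Fin 2 → Derivation ℤ R R}

/-- The set of values `D f` of the derivations killing `x` and `y`, in the `Fin 2` indexing of
`RadicialJungCleanModelsLogContentIdealValued.lean`. [folklore] -/
theorem setOf_nullDerivation_vecCons_eq (x y f : R) :
    {v : R | ∃ D : Derivation ℤ R R, (∀ j, D (![x, y] j) = 0) ∧ D f = v} =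
      {v : R | ∃ D : Derivation ℤ R R, D x = 0 ∧ D y = 0 ∧ D f = v} := by
  ext v
  simp only [Set.mem_setOf_eq]
  constructor
  · rintro ⟨D, h, hf⟩
    exact ⟨D, by simpa using h 0, by simpa using h 1, hf⟩
  · rintro ⟨D, hx, hy, hf⟩
    refine ⟨D, fun j => ?_, hf⟩
    fin_cases j <;> simpa

/-- The same for logarithmic derivations. [folklore] -/
theorem setOf_logDerivation_vecCons_eq (x y f : R) :
    {v : R | ∃ D : Derivation ℤ R R, (∀ j, ![x, y] j ∣ D (![x, y] j)) ∧ D f = v} =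
      {v : R | ∃ D : Derivation ℤ R R, x ∣ D x ∧ y ∣ D y ∧ D f = v} := by
  ext v
  simp only [Set.mem_setOf_eq]
  constructor
  · rintro ⟨D, h, hf⟩
    exact ⟨D, by simpa using h 0, by simpa using h 1, hf⟩
  · rintro ⟨D, hx, hy, hf⟩
    refine ⟨D, fun j => ?_, hf⟩
    fin_cases j <;> simpa

/-- A derivation of `K` preserving `T` restricts to `T`, with prescribed values read in `K`:
packaging of `exists_derivation_restrict`. [folklore] -/
theorem exists_derivation_restrict_eq (D : Derivation ℤ K K) (hD : ∀ t : T, D t ∈ T)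
    {a : T} (v : T) (ha : ∃ c : T, D a = (a : K) * c) :
    ∃ D' : Derivation ℤ T T, a ∣ D' a ∧ ((D' v : T) : K) = D v := by
  obtain ⟨D', hD'⟩ := exists_derivation_restrict T D hD
  obtain ⟨c, hc⟩ := ha
  refine ⟨D', ⟨c, Subtype.ext ?_⟩, hD' v⟩
  rw [hD' a, hc, Subring.coe_mul]

include hRT in
/-- `y = x · (y/x)` in `T`. [folklore] -/
theorem inclusion_snd_eq_mul (hx : (x : K) ≠ 0) (hyx : (y : K) / x ∈ T) :
    Subring.inclusion hRT y = Subring.inclusion hRT x * ⟨(y : K) / x, hyx⟩ := by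
  apply Subtype.ext
  simp only [Subring.coe_inclusion, Subring.coe_mul]
  field_simp

/-- **Giraud 2.5, first sentence, both inclusions: `J(T, f; log x, log y/x) = J(R, f; log x, y)·T`
on the whole blow-up chart `T ⊇ R[y/x]`.** Hypotheses: `Ω[R⁄ℤ]` projective with dual derivations
`∂` of `(x, y)`; `Frac R = K`; `x ≠ 0`, `y/x ∈ T`; `T` stable under the derivations of `K`
preserving `R` and mapping `y/x` into `T`. [cite: Giraud1983, 2.5 and Rem. 1.6 (4)] -/
theorem map_span_logDerivation_eq_span_logDerivation_chart [Module.Projective R Ω[R⁄ℤ]]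
    [IsFractionRing R K] (hδ : ∀ i j, δ i (![x, y] j) = if i = j then 1 else 0)
    (hx : (x : K) ≠ 0) (hyx : (y : K) / x ∈ T)
    (hT : ∀ D : Derivation ℤ K K, (∀ r : R, D r ∈ R) → D ((y : K) / x) ∈ T → ∀ t : T, D t ∈ T) :
    (Ideal.span {v : R | ∃ D : Derivation ℤ R R, x ∣ D x ∧ y ∣ D y ∧ D f = v}).map
        (Subring.inclusion hRT) =
      Ideal.span {w : T | ∃ D : Derivation ℤ T T, Subring.inclusion hRT x ∣ D (Subring.inclusion hRT x) ∧
        (⟨(y : K) / x, hyx⟩ : T) ∣ D ⟨(y : K) / x, hyx⟩ ∧ D (Subring.inclusion hRT f) = w} := by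
  classical
  letI : Algebra R T := (Subring.inclusion hRT).toAlgebra
  have halg : algebraMap R T = Subring.inclusion hRT := rfl
  set y' : T := ⟨(y : K) / x, hyx⟩ with hy'
  have hxy' : Subring.inclusion hRT y = Subring.inclusion hRT x * y' :=
    inclusion_snd_eq_mul hRT hx hyx
  apply le_antisymm
  · -- `⊆`: extend a logarithmic derivation of `R` to `K`, it preserves `T` (Giraud 1.6 (2)–(3))
    rw [Ideal.map_span, Ideal.span_le]
    rintro _ ⟨v, ⟨D, ⟨a, hDx⟩, ⟨b, hDy⟩, rfl⟩, rfl⟩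
    obtain ⟨DK, hDK⟩ := exists_derivation_extend_of_isFractionRing R D
    have hDKR : ∀ r : R, DK r ∈ R := fun r => by rw [hDK]; exact (D r).2
    have hDKx : DK x = (a : K) * x := by rw [hDK, hDx, Subring.coe_mul, mul_comm]
    have hDKy : DK y = (b : K) * y := by rw [hDK, hDy, Subring.coe_mul, mul_comm]
    have hDKyx : DK ((y : K) / x) = ((b : K) - a) * ((y : K) / x) :=
      derivation_apply_div_eq_of_log DK hx hDKx hDKy
    have hDKT : ∀ t : T, DK t ∈ T := hT DK hDKR (by
      rw [hDKyx]
      exact T.mul_mem (T.sub_mem (hRT b.2) (hRT a.2)) hyx)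
    obtain ⟨D', hD'⟩ := exists_derivation_restrict T DK hDKT
    refine Ideal.subset_span ⟨D', ⟨Subring.inclusion hRT a, Subtype.ext ?_⟩,
      ⟨⟨(b : K) - a, T.sub_mem (hRT b.2) (hRT a.2)⟩, Subtype.ext ?_⟩, Subtype.ext ?_⟩
    · rw [hD', Subring.coe_mul, Subring.coe_inclusion, Subring.coe_inclusion, hDKx, mul_comm]
    · rw [hD', Subring.coe_mul, hDKyx, mul_comm]
    · rw [hD', Subring.coe_inclusion, Subring.coe_inclusion, hDK]
  · -- `⊇`: the master lemma (`y/x`-logarithmic and `x`-logarithmic implies `y`-logarithmic)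
    rw [← setOf_logDerivation_vecCons_eq x y f, ← halg]
    refine le_trans ?_ (span_logDerivation_restrict_le_map (T := T) hδ f)
    apply Ideal.span_mono
    rintro w ⟨D', ⟨c, hc⟩, ⟨c', hc'⟩, hw⟩
    refine ⟨D', fun j => ?_, hw⟩
    fin_cases j
    · exact ⟨c, hc⟩
    · change algebraMap R T y ∣ D' (algebraMap R T y)
      rw [halg] at hc ⊢
      rw [hxy', Derivation.leibniz, hc, hc', smul_eq_mul, smul_eq_mul]
      exact ⟨c' + c, by ring⟩

/-- **The non-crossing chart: `J(T, f; log x) = (x ∂_x f, x ∂_y f)·T + N(R, f; x, y)·T` on the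
blow-up chart `T ⊇ R[y/x]` of the exceptional equation `x`** (Giraud 2.5: with `E(f) = div(x)`,
`x∂_x f = x^a A`, `∂_y f = x^a B`, `N = x^a(C_ν)`, this is his `J′ = y^a z^{a-1}(A, yzB, zC_ν)R′` in
the coordinates of the other chart, `= y^a z^a (A + yB, A, C_ν)R′` where `z` is a unit). Same
hypotheses as `map_span_logDerivation_eq_span_logDerivation_chart`. [cite: Giraud1983, 2.5] -/
theorem span_logDerivation_chart_eq_map [Module.Projective R Ω[R⁄ℤ]] [IsFractionRing R K]
    (hδ : ∀ i j, δ i (![x, y] j) = if i = j then 1 else 0)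
    (hx : (x : K) ≠ 0) (hyx : (y : K) / x ∈ T)
    (hT : ∀ D : Derivation ℤ K K, (∀ r : R, D r ∈ R) → D ((y : K) / x) ∈ T → ∀ t : T, D t ∈ T) :
    Ideal.span {w : T | ∃ D : Derivation ℤ T T,
        Subring.inclusion hRT x ∣ D (Subring.inclusion hRT x) ∧ D (Subring.inclusion hRT f) = w} =
      (Ideal.span {x * δ 0 f, x * δ 1 f} ⊔
        Ideal.span {v : R | ∃ D : Derivation ℤ R R, D x = 0 ∧ D y = 0 ∧ D f = v}).map
        (Subring.inclusion hRT) := by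
  classical
  letI : Algebra R T := (Subring.inclusion hRT).toAlgebra
  have halg : algebraMap R T = Subring.inclusion hRT := rfl
  set y' : T := ⟨(y : K) / x, hyx⟩ with hy'
  have hxy' : Subring.inclusion hRT y = Subring.inclusion hRT x * y' :=
    inclusion_snd_eq_mul hRT hx hyx
  have hδ00 : δ 0 x = 1 := by simpa using hδ 0 0
  have hδ01 : δ 0 y = 0 := by simpa using hδ 0 1
  have hδ10 : δ 1 x = 0 := by simpa using hδ 1 0
  have hδ11 : δ 1 y = 1 := by simpa using hδ 1 1
  apply le_antisymm
  · -- `⊆`: the core lemma with `d x, d y ∈ x T`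
    rw [Ideal.span_le]
    rintro _ ⟨D', ⟨c, hc⟩, rfl⟩
    set I : Ideal T := (Ideal.span {x * δ 0 f, x * δ 1 f} ⊔
      Ideal.span {v : R | ∃ D : Derivation ℤ R R, D x = 0 ∧ D y = 0 ∧ D f = v}).map
      (Subring.inclusion hRT) with hI
    have hgen : ∀ j : Fin 2, Subring.inclusion hRT (x * δ j f) ∈ I := fun j => by
      refine Ideal.mem_map_of_mem _ (Ideal.mem_sup_left (Ideal.subset_span ?_))
      fin_cases j
      · exact Or.inl rfl
      · exact Or.inr rfl
    change D' (algebraMap R T f) ∈ I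
    refine derivation_apply_mem_of_forall_mem hδ (D'.compAlgebraMap R) f I (fun j => ?_) ?_
    · change δ j f • D' (algebraMap R T (![x, y] j)) ∈ I
      fin_cases j
      · change δ 0 f • D' (algebraMap R T x) ∈ I
        rw [halg, hc, Algebra.smul_def, halg, ← mul_assoc, ← map_mul, mul_comm (δ 0 f)]
        exact I.mul_mem_right _ (hgen 0)
      · change δ 1 f • D' (algebraMap R T y) ∈ I
        rw [halg, hxy', Derivation.leibniz, hc, smul_eq_mul, smul_eq_mul, Algebra.smul_def, halg]
        have hrw : Subring.inclusion hRT (δ 1 f) *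
            (Subring.inclusion hRT x * D' y' + y' * (Subring.inclusion hRT x * c)) =
            Subring.inclusion hRT (x * δ 1 f) * (D' y' + y' * c) := by
          rw [map_mul]; ring
        rw [hrw]
        exact I.mul_mem_right _ (hgen 1)
    · rw [setOf_nullDerivation_vecCons_eq, halg, hI]
      exact Ideal.map_mono le_sup_right
  · -- `⊇`: the three kinds of generators come from derivations of `K` preserving `T`
    rw [Ideal.map_sup, Ideal.map_span, Ideal.map_span, sup_le_iff, Ideal.span_le, Ideal.span_le]
    obtain ⟨E0, hE0⟩ := exists_derivation_extend_of_isFractionRing R (δ 0)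
    obtain ⟨E1, hE1⟩ := exists_derivation_extend_of_isFractionRing R (δ 1)
    constructor
    · rintro _ ⟨v, hv, rfl⟩
      simp only [Set.mem_insert_iff, Set.mem_singleton_iff] at hv
      rcases hv with rfl | rfl
      · -- `x ∂_x`: `(x∂_x)(y/x) = -y/x`, `(x∂_x) x = x`
        let DK : Derivation ℤ K K := (x : K) • E0
        have hDK : ∀ z, DK z = (x : K) * E0 z := fun z => rfl
        have hDKR : ∀ r : R, DK r ∈ R := fun r => by
          rw [hDK, hE0]; exact R.mul_mem x.2 (δ 0 r).2
        have hDKyx : DK ((y : K) / x) = -((y : K) / x) := by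
          rw [hDK, Derivation.leibniz_div, hE0, hE0, hδ00, hδ01]
          simp only [Subring.coe_one, Subring.coe_zero, smul_eq_mul, mul_zero, mul_one, zero_sub]
          field_simp
        have hDKT := hT DK hDKR (by rw [hDKyx]; exact T.neg_mem hyx)
        obtain ⟨D', hD'x, hD'f⟩ := exists_derivation_restrict_eq DK hDKT
          (a := Subring.inclusion hRT x) (Subring.inclusion hRT f)
          ⟨1, by rw [Subring.coe_one, mul_one, Subring.coe_inclusion, hDK, hE0, hδ00,
            Subring.coe_one, mul_one]⟩
        refine Ideal.subset_span ⟨D', hD'x, Subtype.ext ?_⟩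
        rw [hD'f, Subring.coe_inclusion, Subring.coe_inclusion, hDK, hE0, Subring.coe_mul]
      · -- `x ∂_y`: `(x∂_y)(y/x) = 1`, `(x∂_y) x = 0`
        let DK : Derivation ℤ K K := (x : K) • E1
        have hDK : ∀ z, DK z = (x : K) * E1 z := fun z => rfl
        have hDKR : ∀ r : R, DK r ∈ R := fun r => by
          rw [hDK, hE1]; exact R.mul_mem x.2 (δ 1 r).2
        have hDKyx : DK ((y : K) / x) = 1 := by
          rw [hDK, Derivation.leibniz_div, hE1, hE1, hδ10, hδ11]
          simp only [Subring.coe_one, Subring.coe_zero, smul_eq_mul, mul_zero, mul_one, sub_zero]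
          field_simp
        have hDKT := hT DK hDKR (by rw [hDKyx]; exact T.one_mem)
        obtain ⟨D', hD'x, hD'f⟩ := exists_derivation_restrict_eq DK hDKT
          (a := Subring.inclusion hRT x) (Subring.inclusion hRT f)
          ⟨0, by rw [Subring.coe_zero, mul_zero, Subring.coe_inclusion, hDK, hE1, hδ10,
            Subring.coe_zero, mul_zero]⟩
        refine Ideal.subset_span ⟨D', hD'x, Subtype.ext ?_⟩
        rw [hD'f, Subring.coe_inclusion, Subring.coe_inclusion, hDK, hE1, Subring.coe_mul]
    · rintro _ ⟨v, ⟨D, hDx, hDy, rfl⟩, rfl⟩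
      -- `D x = D y = 0`: `D (y/x) = 0`, `D x = 0`
      obtain ⟨DK, hDK⟩ := exists_derivation_extend_of_isFractionRing R D
      have hDKR : ∀ r : R, DK r ∈ R := fun r => by rw [hDK]; exact (D r).2
      have hDKyx : DK ((y : K) / x) = 0 := by
        rw [Derivation.leibniz_div, hDK, hDK, hDx, hDy]
        simp
      have hDKT := hT DK hDKR (by rw [hDKyx]; exact T.zero_mem)
      obtain ⟨D', hD'x, hD'f⟩ := exists_derivation_restrict_eq DK hDKT
        (a := Subring.inclusion hRT x) (Subring.inclusion hRT f)
        ⟨0, by rw [Subring.coe_zero, mul_zero, Subring.coe_inclusion, hDK, hDx, Subring.coe_zero]⟩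
      refine Ideal.subset_span ⟨D', hD'x, Subtype.ext ?_⟩
      rw [hD'f, Subring.coe_inclusion, Subring.coe_inclusion, hDK]

end Chart

end Summit.ResolutionOfSingularities.ResolutionOfSingularities.Theorems.RadicialJung.CleanModels

end
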